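import Literature.NumberTheory.LFunctions.WeilTwoPrimeOddMarginKDef
import HarnessLib

/-!
# Two-prime odd-margin certificate K: the value of `κ`, `0 ≤ κ' ≤ κ`, the margin, and the scalar side conditions

`weilCert23K.kappaQ` evaluated by the kernel (it involves the `|γ|`-moment `ν'_abs` at `N + 1 = 178` and `max_j bnd_j` over the 248 cells), the margin inequalities for `κ' = weilCert23KKappa'`, and `checkScalars` with `κ` rewritten to its value first. Pure proof file.
-/

noncomputable section

namespace Literature.NumberTheory.LFunctions

set_option maxHeartbeats 0 in
/-- **The value of `κ`** of certificate K. [folklore] -/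
theorem kappaQ_weilCert23K : weilCert23K.kappaQ = weilCert23KKappaLit := by
  have h : decide (weilCert23K.kappaQ = weilCert23KKappaLit) = true := by decide +kernel
  exact of_decide_eq_true h

/-- `0 ≤ κ' ≤ κ` for certificate K. [folklore] -/
theorem kappa'_nonneg_le_weilCert23K : 0 ≤ weilCert23KKappa' ∧ weilCert23KKappa' ≤ weilCert23K.kappaQ := by
  rw [kappaQ_weilCert23K]; unfold weilCert23KKappa' weilCert23KKappaLit; norm_num

/-- The margin `κ − κ'` of certificate K is at least `1/2000000000`. [folklore] -/
theorem margin_weilCert23K : (1/2000000000 : ℚ) ≤ weilCert23K.kappaQ - weilCert23KKappa' := by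
  rw [kappaQ_weilCert23K]; unfold weilCert23KKappa' weilCert23KKappaLit; norm_num

set_option maxHeartbeats 0 in
/-- **Kernel check of the scalar side conditions** of certificate K (`0 < b ≤ a₀ ≤ 1`, `2a₀T ≤ N+2`, Taylor remainder, `N+1 = 2nb`, `κ ≥ 0`), with `κ` rewritten to its value first. [folklore] -/
theorem checkScalars_weilCert23K : weilCert23K.checkScalars = true := by
  have h : weilCert23K.checkScalars = (decide (1 ≤ weilCert23K.j) && decide (0 < weilCert23K.b) && decide (weilCert23K.b ≤ weilCert23K.base.a0) &&
      decide (weilCert23K.base.a0 ≤ 1) && decide (0 < weilCert23K.base.T) && decide (2 * weilCert23K.base.a0 * weilCert23K.base.T ≤ (weilCert23K.base.N : ℚ) + 2) &&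
      decide (2 * (weilCert23K.base.a0 * weilCert23K.base.T) ^ (weilCert23K.base.N + 1) / (weilCert23K.base.N + 1).factorial ≤ 1) &&
      decide (weilCert23K.base.N + 1 = 2 * weilCert23K.base.nb) && decide (0 ≤ weilCert23K.kappaQ)) := rfl
  rw [h, kappaQ_weilCert23K]
  decide +kernel

end Literature.NumberTheory.LFunctions
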